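import Mathlib
import Summits.QuantumAdvantage.QuantumAdvantage.Theses.MobiusLadder
import Literature.NumberTheory.Sieve.PretentiousDistance

/-!
# Sketch (crux-ideate, ideator 2, round 1) — crux `LiouvilleOrthogonalTC0` (stmt-QuantumAdvantage-1393)

First-lemma signatures of the two idea cards, stated over existing declarations only.
Card `katai-window-trichotomy`: `WindowedKatai`, `LiouvilleWalkCLT`, `LiouvilleWalkFidi`,
`LiouvilleOrthogonalBal`.
Card `dilation-rigidity-pretentious`: `IsCM`, `TC0Correlates`, `TC0Pretentious`,
`CruxOfTC0Pretentious`, `cmOf`, `RandomCMOrthogonal`.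
Nothing here is proved; every `def` is a `Prop` (or data) that must ELABORATE.
-/

namespace Summit.QuantumAdvantage.QuantumAdvantage.Cruxes.LiouvilleOrthogonalTC0.Ideator2

open scoped BigOperators
open Filter Finset
open Literature.Computability.Complexity (Circuit tcBasis)
open Literature.Probability.RandomGraphs.LowDegree (sgn)

noncomputable section

/-! ## Card 1 — windowed Kátai inequality (elementary, provable now)

For a completely multiplicative `1`-bounded real `f`, a `1`-bounded test `F`, a finite set `P` of
primes all `≤ X`, `L = Σ_{p∈P} 1/p ≥ 1`, and `c` bounding every RELATIVE dilation correlation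
`|Σ_{1≤m≤X/max(p,q)} F(pm)F(qm)| ≤ c · (X / max(p,q))` (`p ≠ q ∈ P`):
`|Σ_{1≤N≤X} f(N) F(N)| ≤ X · (2√c + 4/√L)`.
Proof (3 steps, all finitary): Turán–Kubilius `Σ_N (ω_P(N) − L)² ≤ XL + 2L|P|`; swap
`Σ_N f F ω_P = Σ_p f(p) Σ_m f(m) F(pm)`; Cauchy–Schwarz in `m` inside dyadic blocks of `p`. -/
def WindowedKatai : Prop :=
  ∀ (f F : ℕ → ℝ), (∀ n, |f n| ≤ 1) → (∀ n, |F n| ≤ 1) → (∀ m n, f (m * n) = f m * f n) →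
  ∀ (X : ℕ) (P : Finset ℕ) (c : ℝ), 0 ≤ c → (∀ p ∈ P, p.Prime ∧ p ≤ X) →
    (1 : ℝ) ≤ ∑ p ∈ P, (1 : ℝ) / p →
    (∀ p ∈ P, ∀ q ∈ P, p ≠ q →
      |∑ m ∈ Icc 1 (X / max p q), F (p * m) * F (q * m)| ≤ c * ((X : ℝ) / max p q)) →
    |∑ N ∈ Icc 1 X, f N * F N| ≤
      (X : ℝ) * (2 * Real.sqrt c + 4 / Real.sqrt (∑ p ∈ P, (1 : ℝ) / p))

/-- The binary digit sum of `N` truncated to the first `n` digits. -/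
def digitSum (n N : ℕ) : ℕ := ((range n).filter fun i => Nat.testBit N i).card

/-- The `±1` digit walk `W_i(N) = Σ_{j<i} (2 x_j − 1)` (as a real number). -/
def walk (i N : ℕ) : ℝ := 2 * (digitSum i N : ℝ) - i

/-! ## Card 1, stub (U) — macroscopic universality of the λ-tilted digit walk
(provable now from the tree's PROVED `bourgain_liouville_walsh_uniform_holds` by the moment
method: all Walsh biases of the tilted digit measure are `≤ 2^{1 − n^{1/10}}`). -/

/-- λ-twisted CLT for the digit sum at every FIXED frequency `t` (characteristic-function form). -/
def LiouvilleWalkCLT : Prop :=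
  ∀ t : ℝ, ∀ ε : ℝ, 0 < ε → ∀ᶠ n : ℕ in atTop,
    |∑ N ∈ range (2 ^ n), ((ArithmeticFunction.liouville N : ℤ) : ℝ) *
        Real.cos (t * walk n N / Real.sqrt n)| ≤ ε * (2 : ℝ) ^ n

/-- λ-twisted functional CLT, finite-dimensional form with bounded continuous test functions of
the walk sampled at `k` equally spaced times: the tilt by `λ` is invisible to every such
macroscopic statistic. -/
def LiouvilleWalkFidi : Prop :=
  ∀ k : ℕ, 0 < k → ∀ Φ : (Fin k → ℝ) → ℝ, Continuous Φ → (∀ v, |Φ v| ≤ 1) →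
    ∀ ε : ℝ, 0 < ε → ∀ᶠ n : ℕ in atTop,
      |∑ N ∈ range (2 ^ n), ((ArithmeticFunction.liouville N : ℤ) : ℝ) *
          Φ (fun i : Fin k => walk (((i : ℕ) + 1) * n / k) N / Real.sqrt n)| ≤ ε * (2 : ℝ) ^ n

/-- The balance-point majority `BAL(N) = MAJ_{i<n} sgn(2 W_i − W_n)`: a depth-2 `MAJ ∘ MAJ`
circuit with `n` bottom gates of `±1` weights; not monotone, not automatic, not
Fourier-concentrated by any proved bound — but a MACROSCOPIC (arcsine-law) functional. -/
def bal (n N : ℕ) : Bool :=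
  decide (0 < ∑ i ∈ range n, Real.sign (2 * walk i N - walk n N))

/-- Concrete new depth-2 instance predicted by stub (U): `λ ⊥ BAL`. -/
def LiouvilleOrthogonalBal : Prop :=
  ∀ ε : ℝ, 0 < ε → ∀ᶠ n : ℕ in atTop,
    |∑ N ∈ range (2 ^ n), ((ArithmeticFunction.liouville N : ℤ) : ℝ) * sgn (bal n N)| ≤
      ε * (2 : ℝ) ^ n

/-! ## Card 2 — dilation rigidity / pretentious inverse theorem at the TC⁰ level -/

/-- Completely multiplicative integer-valued function (`f(mn) = f(m) f(n)` for ALL `m, n`). -/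
def IsCM (f : ℕ → ℤ) : Prop := f 1 = 1 ∧ ∀ m n, f (m * n) = f m * f n

/-- `f` correlates with SOME polynomial-size constant-depth threshold-circuit family infinitely
often (the negation, for `f = λ`, is exactly the crux). -/
def TC0Correlates (f : ℕ → ℤ) : Prop :=
  ∃ d : ℕ, ∃ p : Polynomial ℕ, ∃ ε : ℝ, 0 < ε ∧ ∃ᶠ n : ℕ in atTop,
    ∃ C : Circuit (Fin n), C.IsOver tcBasis ∧ C.acDepth ≤ d ∧ C.size ≤ p.eval n ∧
      ε * (2 : ℝ) ^ n < |∑ N ∈ range (2 ^ n), ((f N : ℤ) : ℝ) *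
        sgn (C.eval (fun i : Fin n => Nat.testBit N i))|

/-- **Transfer C⁺ of card 2** (inverse theorem): a completely multiplicative `±1`-on-primes
function seen by `TC⁰` pretends to be a (real) Dirichlet character. -/
def TC0Pretentious : Prop :=
  ∀ f : ℕ → ℤ, IsCM f → (∀ p : ℕ, p.Prime → f p = 1 ∨ f p = -1) → TC0Correlates f →
    ¬ Literature.NumberTheory.Sieve.IsNonpretentious (fun n => (f n : ℂ))

/-- The glue of card 2 (one contrapositive + the PROVED tree theorem
`Literature.NumberTheory.LFunctions.isNonpretentious_liouville_holds`). -/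
def CruxOfTC0Pretentious : Prop :=
  TC0Pretentious → Literature.NumberTheory.Sieve.isNonpretentious_liouville →
    Summit.QuantumAdvantage.QuantumAdvantage.Theses.MobiusLadder.LiouvilleOrthogonalTC0

/-- The completely multiplicative `±1` function with sign pattern `σ` on the primes. -/
def cmOf (σ : ℕ → Bool) (N : ℕ) : ℤ :=
  N.factorization.prod fun p k => (if σ p then (-1 : ℤ) else 1) ^ k

/-- **Card 2, first deliverable (provable now; McDiarmid over the primes `> 2^{√n}` after
bounding the conditional expectation by the count of `N < 2^n` whose `2^{√n}`-rough part is a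
square):** for every `1`-bounded test `F` on `[0, 2^n)` — in particular every Boolean circuit —
the fraction of sign patterns `σ` whose completely multiplicative function `f_σ` has correlation
`≥ ε` with `F` is at most `2·exp(−ε² 2^{√n}/16)`; a union bound over the `2^{poly(n)}`
polynomial-size circuits makes Haar-almost every `f_σ` satisfy the crux (indeed `⊥ P/poly`). -/
def RandomCMOrthogonal : Prop :=
  ∀ ε : ℝ, 0 < ε → ∀ᶠ n : ℕ in atTop, ∀ F : ℕ → ℝ, (∀ N, |F N| ≤ 1) →
    ((((Finset.univ : Finset (Fin (2 ^ n) → Bool)).filter fun σ =>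
        ε * (2 : ℝ) ^ n ≤ |∑ N ∈ range (2 ^ n),
          ((cmOf (fun p => if h : p < 2 ^ n then σ ⟨p, h⟩ else false) N : ℤ) : ℝ) * F N|).card : ℝ)
      ≤ 2 * Real.exp (-(ε ^ 2 * (2 : ℝ) ^ Real.sqrt n / 16)) * (2 : ℝ) ^ (2 ^ n))

end

end Summit.QuantumAdvantage.QuantumAdvantage.Cruxes.LiouvilleOrthogonalTC0.Ideator2
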